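import Summits.Langlands.Langlands.Theorems.IrreducibilityBySelfDualityPairLBoundaryJSLocalPairTranslate
import Literature.NumberTheory.Automorphic.ArchRankinSelbergCornerTestVector
import Literature.NumberTheory.Automorphic.CornerTorusIwasawaData
import Summits.Langlands.Langlands.Theorems.IrreducibilityBySelfDualityPairLBoundaryJSCornerArchFactorData
import Summits.Langlands.Langlands.Theorems.IrreducibilityBySelfDualityPairLBoundaryJSCornerLocalSingleDatum

/-!
# Crux `PairLBoundaryJS` (stmt-Langlands-13622), line `Sketch` — the corner local control (W-CLC) assembled
# from the archimedean corner data (W-CAFD) and the single-datum realisation (W-CLSD)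

Summit `Langlands`, sub-problem `Langlands`, helper file under `Theorems/` supporting the crux `PairLBoundaryJS`
(Arthur–Clozel (1989), Ch. 3, (2.2)), line `Sketch`, skeleton v16 (lead c5). `corner_local_control_of_parts` is the
implication `(W-CAFD) → (W-CLSD) → (W-CLC)`: the corner (`GL_{m+1} × GL_m`) LOCAL Rankin–Selberg theory in
translate form follows from the archimedean corner data with their reciprocal entire factor (Jacquet (2009),
Thm. 2.7 (i); `CornerArchFactorData`) and the realisation of ONE archimedean corner datum inside the translated corner
box integral (`CornerLocalSingleDatum`) — the corner transcription of `LocalPairTranslate.stub_local_pair_translate`: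
the torus of Whittaker shifts off `S₀` in rank `m + 1` (`WhittakerShiftTorusOffIntegral`) is `snoc τ 1` (last entry
`1`) and the rank-`m` facts for `diag τ` are read off the rank-`(m + 1)` ones entry by entry
(`localComponent_glDiagonal`, `GLn.toMixed_glDiagonal`, `glDiagonal_eq_one_iff`); the archimedean components
(`exists_archComponent_decomposition`); initial pure tensors with non-zero translated transferred Whittaker functionals
(`InitialVectorTranslateNeZero`, for `π` with `diag(τ, 1)`, for `σ` with `diag τ`); the data `(e_i, e'_i, Λ, x₀)` of
W-CAFD for the image Haar measures (`isHaarMeasure_map_archTorusOfIdele`, `isHaarMeasure_map_kinfOfMaximalCompact`);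
each datum realised by W-CLSD with `κ_i > 0`; `c_i := κ_i⁻¹`, one level `𝔫₀ := ∏_i 𝔫_i`
(`principalCongruenceLevel_mono`, `exists_dvd_of_dvd_prod`), `x₁ := x₀`.

References: Jacquet–Piatetski-Shapiro–Shalika, Amer. J. Math. 105 (1983), Thm. 2.7
[JacquetPiatetskiShapiroShalika1983]; Cogdell, *Analytic theory of L-functions for GL_n* (2004), §3.2, §4.1
[CogdellAnalyticTheory2004]; Jacquet, Contemp. Math. 489 (2009), Thm. 2.7 (i) [JacquetArchimedeanRS2009].
-/

noncomputable section

-- `Summit.Langlands.Langlands.…` (summit = sub-problem name, D-0017 layout) trips `dupNamespace`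
set_option linter.dupNamespace false

open scoped MatrixGroups Topology Pointwise ENNReal NNReal ComplexConjugate InnerProductSpace ContDiff
-- the place subtypes indexing `mixedSpace K` are `Fintype` classically (`NormedCommRing (mixedSpace K)`)
open scoped Classical Matrix.Norms.Operator
open NumberField IsDedekindDomain MeasureTheory Measure Matrix Set Filter WithZero
open NumberField.mixedEmbedding
open Literature.NumberTheory.Automorphic AdelicGroupData
open Literature.NumberTheory.GaloisRepresentations (ideleGroup HeckeCharacter)
open Literature.MeasureTheory.Group
open ValuativeRel

-- the automorphic quotient carries the tree's Borel σ-algebra, not Mathlib's quotient σ-algebra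
attribute [-instance] Quotient.instMeasurableSpace QuotientGroup.measurableSpace

-- the house local instances, exactly as in `RankinSelbergUnfoldingIdentity`
attribute [local instance] adelicBorel borelSpace_adelic locallyCompactSpace_adelic secondCountableTopology_gl_adelic
  glAdeleBorel borelSpace_glAdele borelSpace_ideleGroup secondCountableTopology_ideleGroup

-- Mathlib idiom: the commutator Lie ring on matrices, to mention `(archGroupGL n K).lie`
attribute [local instance 100] LieRing.ofAssociativeRing

-- Borel structures on the archimedean unit groups (house pattern of `ArchRankinSelbergPairBridge`)
attribute [local instance] Literature.MeasureTheory.Group.Units.borelSpace_of_isOpenEmbedding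
  Literature.MeasureTheory.Group.Units.secondCountableTopology
  Literature.MeasureTheory.Group.Units.locallyCompactSpace

namespace Summit.Langlands.Langlands.Theorems.CornerLocalControlAsm

/-! ### Diagonal torus elements: rank `m + 1` versus rank `m` -/

/-- `glDiagonal` is injective (compare diagonal entries). [folklore] -/
theorem glDiagonal_injective {R : Type*} [CommRing R] (n : ℕ) :
    Function.Injective (glDiagonal n R) := by
  intro d d' h
  funext i
  have hi := congrArg (fun g : GL (Fin n) R => (g : Matrix (Fin n) (Fin n) R) i i) h
  simp only [coe_glDiagonal, Matrix.diagonal_apply_eq] at hi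
  exact Units.val_injective hi

/-- `diag d = 1` iff every entry `d i` is `1`. [folklore] -/
theorem glDiagonal_eq_one_iff {R : Type*} [CommRing R] {n : ℕ} (d : Fin n → Rˣ) :
    glDiagonal n R d = 1 ↔ ∀ i, d i = 1 :=
  ⟨fun h i => congrFun (glDiagonal_injective n (h.trans (map_one (glDiagonal n R)).symm)) i,
    fun h => (congrArg (glDiagonal n R) (funext h : d = 1)).trans (map_one _)⟩

/-- The `v`-component of `diag(a)`, `a ∈ (𝔸_Kˣ)ⁿ`, is the diagonal matrix of the `v`-components
`diag(a_v)`. [folklore] -/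
theorem localComponent_glDiagonal {n : ℕ} {K : Type} [Field K] [NumberField K]
    (v : HeightOneSpectrum (𝓞 K)) (a : Fin n → ideleGroup K) :
    localComponent v (glDiagonal n (AdeleRing (𝓞 K) K) a) =
      glDiagonal n (v.adicCompletion K) fun i =>
        Units.map (AdelicGroupData.adeleEval K v : AdeleRing (𝓞 K) K →+* v.adicCompletion K).toMonoidHom (a i) :=
  generalLinearGroup_map_glDiagonal _ a

/-! ### The assembly -/

set_option maxHeartbeats 1600000 in
/-- **The corner local control assembled from its parts**: `(W-CAFD) → (W-CLSD) → (W-CLC)`, where W-CLC is the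
statement of the registered stub `stub_corner_local_control` (the Jacquet-conditional corner LOCAL Rankin–Selberg
theory in translate form), W-CAFD that of `CornerArchFactorData.stub_corner_arch_factor_data` and W-CLSD that of
`CornerLocalSingleDatum.stub_corner_local_single_datum` (v2). See the module docstring for the assembly.
[cite: JacquetPiatetskiShapiroShalika1983, Thm. 2.7] [cite: CogdellAnalyticTheory2004, §3.2 and §4.1]
[cite: JacquetArchimedeanRS2009, Thm. 2.7 (i) (p. 10)] -/
theorem corner_local_control_of_parts :
    (∀ {m : ℕ} {K : Type} [Field K] [NumberField K],
      JacquetArchimedeanRS2009_archRankinSelbergCorner_testVector m K →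
    ∀ (hcpt : isCompact_glFiniteIntegralLevel (m + 1) K) (hcpt' : isCompact_glFiniteIntegralLevel m K)
      (E : Type) [NormedAddCommGroup E] [InnerProductSpace ℂ E] [CompleteSpace E]
      (τ : ContRepresentation ℂ (AutomorphyDatum.gl (m + 1) K hcpt).arch.carrier E) (hτ : τ.IsStronglyContinuous)
      (_ : τ.IsUnitary) (_ : τ.IsTopIrreducible)
      (ℓ : archGardingSpace hcpt τ →ₗ[ℂ] ℂ) (_ : IsArchContWhittakerFunctional hcpt τ hτ ℓ) (_ : ℓ ≠ 0)
      (E' : Type) [NormedAddCommGroup E'] [InnerProductSpace ℂ E'] [CompleteSpace E']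
      (τ' : ContRepresentation ℂ (AutomorphyDatum.gl m K hcpt').arch.carrier E') (hτ' : τ'.IsStronglyContinuous)
      (_ : τ'.IsUnitary) (_ : τ'.IsTopIrreducible)
      (ℓ' : archGardingSpace hcpt' τ' →ₗ[ℂ] ℂ) (_ : IsArchContWhittakerFunctional hcpt' τ' hτ' ℓ') (_ : ℓ' ≠ 0)
      [MeasurableSpace (GL (Fin m) (mixedSpace K))] [BorelSpace (GL (Fin m) (mixedSpace K))]
      [MeasurableSpace ((mixedSpace K)ˣ)] [BorelSpace ((mixedSpace K)ˣ)]
      (μA : Measure (Fin m → (mixedSpace K)ˣ)) (_ : IsHaarMeasure μA)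
      (μK : Measure ↥(Kinf m K)) (_ : IsHaarMeasure μK),
      ∃ (k : ℕ) (e : Fin k → archGardingSpace hcpt τ) (e' : Fin k → archGardingSpace hcpt' τ')
        (_ : ∀ i, FiniteDimensional ℂ (Submodule.span ℂ (Set.range
          fun κ : (AutomorphyDatum.gl (m + 1) K hcpt).arch.maximalCompact =>
            τ (toArch hcpt (κ : GL (Fin (m + 1)) (mixedSpace K))) (e i : E))))
        (_ : ∀ i, FiniteDimensional ℂ (Submodule.span ℂ (Set.range
          fun κ : (AutomorphyDatum.gl m K hcpt').arch.maximalCompact =>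
            τ' (toArch hcpt' (κ : GL (Fin m) (mixedSpace K))) (e' i : E'))))
        (Λ : ℂ → ℂ) (x₀ : ℝ), Differentiable ℂ Λ ∧ ∀ s : ℂ, x₀ < s.re →
          Λ s * ∑ i, archCornerPairIntegralCplx hcpt hcpt' τ hτ τ' hτ' ℓ ℓ' (e i) (e' i) μA μK s = 1) →
    (∀ {m : ℕ} {K : Type} [Field K] [NumberField K]
      {μ : Measure (gl (m + 1) K).automorphicQuotient} [(gl (m + 1) K).IsAutomorphicMeasure μ]
      {μ' : Measure (gl m K).automorphicQuotient} [(gl m K).IsAutomorphicMeasure μ']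
      [MeasurableSpace (AdeleRing (𝓞 K) K)] [BorelSpace (AdeleRing (𝓞 K) K)] (_ : 0 < m)
      (hcpt : isCompact_glFiniteIntegralLevel (m + 1) K) (hcpt' : isCompact_glFiniteIntegralLevel m K)
      (P : CuspidalAutomorphicRepGL (m + 1) K μ) (Q : CuspidalAutomorphicRepGL m K μ')
      (νA : Measure (Fin m → ideleGroup K)) [IsHaarMeasure νA]
      (νK : Measure ↥(maximalCompactAdelic m K)) [IsHaarMeasure νK]
      (ν₀ : Measure ↥(adelicUnipotent (m + 1) K)) [IsHaarMeasure ν₀]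
      (ν₀' : Measure ↥(adelicUnipotent m K)) [IsHaarMeasure ν₀']
      {E : Type} [NormedAddCommGroup E] [InnerProductSpace ℂ E] [CompleteSpace E]
      {τP : ContRepresentation ℂ (archGroupGL (m + 1) K).carrier E} (hτPc : τP.IsStronglyContinuous)
      {E' : Type} [NormedAddCommGroup E'] [InnerProductSpace ℂ E'] [CompleteSpace E']
      {τQ : ContRepresentation ℂ (archGroupGL m K).carrier E'} (hτQc : τQ.IsStronglyContinuous)
      (S₀ : Finset (HeightOneSpectrum (𝓞 K))) (τ : Fin m → ideleGroup K)
      (_ : GLn.toMixed m K (glDiagonal m (AdeleRing (𝓞 K) K) τ) = 1)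
      (_ : ∀ v ∈ S₀, localComponent v (glDiagonal m (AdeleRing (𝓞 K) K) τ) = 1)
      {𝔫P 𝔫Q : Ideal (𝓞 K)} (_ : 𝔫P ≠ 0) (_ : 𝔫Q ≠ 0)
      (_ : ∀ w ∉ S₀, ¬ w.asIdeal ∣ 𝔫P * 𝔫Q)
      (S₁ : multiplicityModule hcpt τP P.1)
      (_ : (S₁ : E →L[ℂ] (gl (m + 1) K).L2 μ) ∈ archIntertwinersLevel hcpt τP P.1 (finitePrincipalCongruenceLevel (m + 1) K 𝔫P))
      (S₁' : multiplicityModule hcpt' τQ Q.1)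
      (_ : (S₁' : E' →L[ℂ] (gl m K).L2 μ') ∈ archIntertwinersLevel hcpt' τQ Q.1 (finitePrincipalCongruenceLevel m K 𝔫Q))
      (e : archGardingSpace hcpt τP) (e' : archGardingSpace hcpt' τQ)
      (_ : FiniteDimensional ℂ (Submodule.span ℂ (Set.range
        fun κ : ↥(Kinf (m + 1) K) => τP (toArch hcpt κ.1) e.1)))
      (_ : FiniteDimensional ℂ (Submodule.span ℂ (Set.range
        fun κ : ↥(Kinf m K) => τQ (toArch hcpt' κ.1) e'.1)))
      [MeasurableSpace (GL (Fin m) (mixedSpace K))] [BorelSpace (GL (Fin m) (mixedSpace K))],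
    ∃ (𝔫 : Ideal (𝓞 K)) (_ : 𝔫 ≠ 0) (_ : ∀ w ∉ S₀, ¬ w.asIdeal ∣ 𝔫)
      (Φ : (gl (m + 1) K).automorphicQuotient → ℂ) (Φ' : (gl m K).automorphicQuotient → ℂ)
      (sv : P.1.toSubmodule) (sv' : Q.1.toSubmodule) (_ : Continuous Φ) (_ : Continuous Φ')
      (_ : ((sv : (gl (m + 1) K).L2 μ) : _ → ℂ) =ᵐ[μ] Φ)
      (_ : ((sv' : (gl m K).L2 μ') : _ → ℂ) =ᵐ[μ'] Φ')
      (_ : IsCuspFormGL (m + 1) K hcpt (invQuot (gl (m + 1) K) Φ))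
      (_ : IsCuspFormGL m K hcpt' (invQuot (gl m K) Φ'))
      (_ : ∀ u ∈ principalCongruenceLevel (m + 1) K 𝔫, ∀ y, invQuot (gl (m + 1) K) Φ (y * u :) = invQuot (gl (m + 1) K) Φ y)
      (_ : ∀ u ∈ principalCongruenceLevel m K 𝔫, ∀ y, invQuot (gl m K) Φ' (y * u :) = invQuot (gl m K) Φ' y)
      (κ : ℝ), 0 < κ ∧
      ∀ s,
        ∫ p in unitBox {v | v ∉ (↑S₀ : Set _)} ×ˢ univ,
          torusPairIntegrandC m K
            (fun g => whittakerCoeff ν₀ (unipotentTateDomain (m + 1) K) (adeleAddChar K) (invQuot (gl (m + 1) K) Φ)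
              (glDiagonal (m + 1) (AdeleRing (𝓞 K) K) (Fin.snoc τ 1) * glCorner (AdeleRing (𝓞 K) K) (Nat.le_succ m) g))
            (fun g => star (whittakerCoeff ν₀' (unipotentTateDomain m K) (adeleAddChar K) (invQuot (gl m K) Φ')
              (glDiagonal m (AdeleRing (𝓞 K) K) τ * g)))
            (fun _ => 1) s p ∂(νA.prod νK) =
        (κ : ℂ) * archCornerPairIntegralCplx hcpt hcpt' τP hτPc τQ hτQc
          (transferMap (whittakerFunctional ν₀ (continuous_adeleAddChar K) (ContRepresentation.Equiv.refl P.1.toContRep)) hτPc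
            (finComponentRep hcpt τP P.1 (GLn.sndHom (m + 1) K (glDiagonal (m + 1) (AdeleRing (𝓞 K) K) (Fin.snoc τ 1))) S₁))
          (transferMap (whittakerFunctional ν₀' (continuous_adeleAddChar K) (ContRepresentation.Equiv.refl Q.1.toContRep)) hτQc
            (finComponentRep hcpt' τQ Q.1 (GLn.sndHom m K (glDiagonal m (AdeleRing (𝓞 K) K) τ)) S₁')) e e'
          ((νA.restrict (unitBox univ)).map (archTorusOfIdele m K)) (νK.map (kinfOfMaximalCompact m K)) s) →

    (∀ (N : ℕ) (K : Type) [Field K] [NumberField K],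
      JacquetArchimedeanRS2009_archRankinSelbergCorner_testVector N K) →
    ∀ {m : ℕ} {K : Type} [Field K] [NumberField K]
      {μ : Measure (AdelicGroupData.gl (m + 1) K).automorphicQuotient}
      [(AdelicGroupData.gl (m + 1) K).IsAutomorphicMeasure μ]
      {μ' : Measure (AdelicGroupData.gl m K).automorphicQuotient} [(AdelicGroupData.gl m K).IsAutomorphicMeasure μ']
      [MeasurableSpace (AdeleRing (𝓞 K) K)] [BorelSpace (AdeleRing (𝓞 K) K)] (_hm : 0 < m)
      (νA : Measure (Fin m → ideleGroup K)) [IsHaarMeasure νA]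
      (νK : Measure ↥(maximalCompactAdelic m K)) [IsHaarMeasure νK]
      (ν₀ : Measure ↥(adelicUnipotent (m + 1) K)) [IsHaarMeasure ν₀]
      (ν₀' : Measure ↥(adelicUnipotent m K)) [IsHaarMeasure ν₀']
      (P : CuspidalAutomorphicRepGL (m + 1) K μ) (Q : CuspidalAutomorphicRepGL m K μ')
      (S₀ : Finset (HeightOneSpectrum (𝓞 K))), (∀ v ∉ S₀, IsUnramifiedAt P.1 v ∧ IsUnramifiedAt Q.1 v) →
      ∃ (τ : Fin m → ideleGroup K),
      (∀ v ∉ S₀, ∃ (d : Fin (m + 1) → (v.adicCompletion K)ˣ) (a : (v.adicCompletion K)ˣ),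
        localComponent v (glDiagonal (m + 1) (AdeleRing (𝓞 K) K) (Fin.snoc τ 1)) =
          diagonalGL (Fin (m + 1)) (v.adicCompletion K) d ∧
        (∀ i j : Fin (m + 1), (i : ℕ) + 1 = j →
          (d i : v.adicCompletion K) * ((d j)⁻¹ : (v.adicCompletion K)ˣ) = a) ∧
        (∀ c ∈ 𝒪[v.adicCompletion K], (adeleAddChar K).adicComponent v (a * c) = 1) ∧
        ∀ ϖ : v.adicCompletion K, Valued.v ϖ = WithZero.exp (-1 : ℤ) →
          ∃ c ∈ 𝒪[v.adicCompletion K], (adeleAddChar K).adicComponent v (a * (ϖ⁻¹ * c)) ≠ 1) ∧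
      ∃ (k : ℕ) (c : Fin k → ℂ)
        (Φ : Fin k → (AdelicGroupData.gl (m + 1) K).automorphicQuotient → ℂ)
        (Φ' : Fin k → (AdelicGroupData.gl m K).automorphicQuotient → ℂ)
        (sv : Fin k → P.1.toSubmodule) (sv' : Fin k → Q.1.toSubmodule) (𝔫₀ : Ideal (𝓞 K)),
      𝔫₀ ≠ 0 ∧ (∀ w : HeightOneSpectrum (𝓞 K), w.asIdeal ∣ 𝔫₀ → w ∈ S₀) ∧
      (∀ i, Continuous (Φ i)) ∧ (∀ i, Continuous (Φ' i)) ∧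
      (∀ i, (((sv i : (AdelicGroupData.gl (m + 1) K).L2 μ) : (AdelicGroupData.gl (m + 1) K).automorphicQuotient → ℂ)
        =ᵐ[μ] Φ i)) ∧
      (∀ i, (((sv' i : (AdelicGroupData.gl m K).L2 μ') : (AdelicGroupData.gl m K).automorphicQuotient → ℂ)
        =ᵐ[μ'] Φ' i)) ∧
      (∀ i, IsCuspFormGL (m + 1) K (isCompact_glFiniteIntegralLevel_holds (m + 1) K)
        (invQuot (AdelicGroupData.gl (m + 1) K) (Φ i))) ∧
      (∀ i, IsCuspFormGL m K (isCompact_glFiniteIntegralLevel_holds m K) (invQuot (AdelicGroupData.gl m K) (Φ' i))) ∧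
      (∀ i, ∀ u ∈ principalCongruenceLevel (m + 1) K 𝔫₀, ∀ y : GL (Fin (m + 1)) (AdeleRing (𝓞 K) K),
        invQuot (AdelicGroupData.gl (m + 1) K) (Φ i) (y * u) = invQuot (AdelicGroupData.gl (m + 1) K) (Φ i) y) ∧
      (∀ i, ∀ u ∈ principalCongruenceLevel m K 𝔫₀, ∀ y : GL (Fin m) (AdeleRing (𝓞 K) K),
        invQuot (AdelicGroupData.gl m K) (Φ' i) (y * u) = invQuot (AdelicGroupData.gl m K) (Φ' i) y) ∧
      ∃ (Λ : ℂ → ℂ) (x₁ : ℝ), Differentiable ℂ Λ ∧ ∀ s : ℂ, x₁ < s.re →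
        Λ s * ∑ i, c i * ∫ p in unitBox {v | v ∉ (↑S₀ : Set (HeightOneSpectrum (𝓞 K)))} ×ˢ Set.univ,
          torusPairIntegrandC m K
            (fun g => whittakerCoeff ν₀ (unipotentTateDomain (m + 1) K) (adeleAddChar K)
              (invQuot (AdelicGroupData.gl (m + 1) K) (Φ i))
              (glDiagonal (m + 1) (AdeleRing (𝓞 K) K) (Fin.snoc τ 1) * glCorner (AdeleRing (𝓞 K) K) (Nat.le_succ m) g))
            (fun g => star (whittakerCoeff ν₀' (unipotentTateDomain m K) (adeleAddChar K)
              (invQuot (AdelicGroupData.gl m K) (Φ' i)) (glDiagonal m (AdeleRing (𝓞 K) K) τ * g)))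
            (fun _ => (1 : ℝ)) s p ∂(νA.prod νK) = 1 := by
  intro hCAFD hCLSD hJ m K _ _ μ _ μ' _ _ _ hm νA _ νK _ ν₀ _ ν₀' _ P Q S₀ hunr
  have hcpt : isCompact_glFiniteIntegralLevel (m + 1) K := isCompact_glFiniteIntegralLevel_holds (m + 1) K
  have hcpt' : isCompact_glFiniteIntegralLevel m K := isCompact_glFiniteIntegralLevel_holds m K
  -- (1) the torus of Whittaker shifts off `S₀` in rank `m + 1`; its last entry is `1`, so it is `snoc τ 1`
  obtain ⟨t, -, -, -, hlast, hDinf, hDS₀, hoff⟩ :=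
    WhittakerShiftTorusOffIntegral.stub_whittakerShiftTorus_off_integral (m + 1) K S₀
  obtain ⟨τ, rfl⟩ : ∃ τ : Fin m → ideleGroup K, (Fin.snoc τ 1 : Fin (m + 1) → ideleGroup K) = t := by
    refine ⟨Fin.init t, ?_⟩
    have h1 : t (Fin.last m) = 1 := by
      rw [lastEntry, dif_pos (Nat.succ_pos m)] at hlast
      exact hlast
    conv_rhs => rw [← Fin.snoc_init_self t, h1]
  -- the rank-`m` facts for `D' = diag τ`, read off the rank-`(m + 1)` facts for `D = diag(snoc τ 1)`
  have hD'inf : GLn.toMixed m K (glDiagonal m (AdeleRing (𝓞 K) K) τ) = 1 := by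
    rw [GLn.toMixed_glDiagonal, glDiagonal_eq_one_iff] at hDinf ⊢
    exact fun i => by simpa only [Fin.snoc_castSucc] using hDinf (Fin.castSucc i)
  have hD'S₀ : ∀ v ∈ S₀, localComponent v (glDiagonal m (AdeleRing (𝓞 K) K) τ) = 1 := by
    intro v hv
    have h := hDS₀ v hv
    rw [localComponent_glDiagonal, glDiagonal_eq_one_iff] at h ⊢
    exact fun i => by simpa only [Fin.snoc_castSucc] using h (Fin.castSucc i)
  have hoff' : ∀ v ∉ S₀, ∃ (d : Fin m → (v.adicCompletion K)ˣ) (a : (v.adicCompletion K)ˣ),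
      localComponent v (glDiagonal m (AdeleRing (𝓞 K) K) τ) = diagonalGL (Fin m) (v.adicCompletion K) d ∧
      (∀ i j : Fin m, (i : ℕ) + 1 = j →
        (d i : v.adicCompletion K) * ((d j)⁻¹ : (v.adicCompletion K)ˣ) = a) ∧
      (∀ c ∈ 𝒪[v.adicCompletion K], (adeleAddChar K).adicComponent v (a * c) = 1) ∧
      ∀ ϖ : v.adicCompletion K, Valued.v ϖ = WithZero.exp (-1 : ℤ) →
        ∃ c ∈ 𝒪[v.adicCompletion K], (adeleAddChar K).adicComponent v (a * (ϖ⁻¹ * c)) ≠ 1 := by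
    intro v hv
    obtain ⟨d, a, hd, hratio, hψ⟩ := hoff v hv
    refine ⟨Fin.init d, a, ?_, fun i j hij => hratio (Fin.castSucc i) (Fin.castSucc j) hij, hψ⟩
    rw [localComponent_glDiagonal, ← glDiagonal_eq_diagonalGL] at hd ⊢
    have hinj := glDiagonal_injective (m + 1) hd
    congr 1
    funext i
    simpa only [Fin.init, Fin.snoc_castSucc] using congrFun hinj (Fin.castSucc i)
  refine ⟨τ, hoff, ?_⟩
  -- (2) the archimedean components of `π` and `σ`
  obtain ⟨E, _, _, _, τP, hτPi, hτPu, hτPc, hexP, -⟩ := exists_archComponent_decomposition (hcpt := hcpt) P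
  obtain ⟨E', _, _, _, τQ, hτQi, hτQu, hτQc, hexQ, -⟩ := exists_archComponent_decomposition (hcpt := hcpt') Q
  -- (3) initial pure tensors of levels supported on `S₀`, with non-zero translated transferred functionals
  obtain ⟨𝔫P, h𝔫P, hsuppP, S₁, hS₁, w, hw⟩ :=
    InitialVectorTranslateNeZero.stub_initialVector_translate_ne_zero hcpt (Nat.succ_le_succ (Nat.zero_le m)) P
      hτPu hτPi hτPc hexP ν₀ S₀ (fun v hv => (hunr v hv).1) (Fin.snoc τ 1) hDS₀ hoff
  obtain ⟨𝔫Q, h𝔫Q, hsuppQ, S₁', hS₁', w', hw'⟩ :=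
    InitialVectorTranslateNeZero.stub_initialVector_translate_ne_zero hcpt' hm Q
      hτQu hτQi hτQc hexQ ν₀' S₀ (fun v hv => (hunr v hv).2) τ hD'S₀ hoff'
  -- (4) the archimedean Whittaker functionals `Φ_λ(D_f S₁)` and `Φ_λ'(D'_f S₁')`
  have hlamP := isContWhittakerFunctional_whittakerFunctional ν₀ (continuous_adeleAddChar K)
    (isGlobalAddChar_adeleAddChar K) (ContRepresentation.Equiv.refl P.1.toContRep)
  have hlamQ := isContWhittakerFunctional_whittakerFunctional ν₀' (continuous_adeleAddChar K)
    (isGlobalAddChar_adeleAddChar K) (ContRepresentation.Equiv.refl Q.1.toContRep)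
  have hℓ : IsArchContWhittakerFunctional hcpt τP hτPc
      (transferMap (whittakerFunctional ν₀ (continuous_adeleAddChar K) (ContRepresentation.Equiv.refl P.1.toContRep))
        hτPc (finComponentRep hcpt τP P.1
          (GLn.sndHom (m + 1) K (glDiagonal (m + 1) (AdeleRing (𝓞 K) K) (Fin.snoc τ 1))) S₁)) :=
    transferMap_mem_archContWhittakerFunctionals hlamP hτPc _
  have hℓ' : IsArchContWhittakerFunctional hcpt' τQ hτQc
      (transferMap (whittakerFunctional ν₀' (continuous_adeleAddChar K) (ContRepresentation.Equiv.refl Q.1.toContRep))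
        hτQc (finComponentRep hcpt' τQ Q.1 (GLn.sndHom m K (glDiagonal m (AdeleRing (𝓞 K) K) τ)) S₁')) :=
    transferMap_mem_archContWhittakerFunctionals hlamQ hτQc _
  have hℓ0 : transferMap (whittakerFunctional ν₀ (continuous_adeleAddChar K) (ContRepresentation.Equiv.refl P.1.toContRep))
      hτPc (finComponentRep hcpt τP P.1
        (GLn.sndHom (m + 1) K (glDiagonal (m + 1) (AdeleRing (𝓞 K) K) (Fin.snoc τ 1))) S₁) ≠ 0 :=
    fun h => hw (by rw [h, LinearMap.zero_apply])
  have hℓ'0 : transferMap (whittakerFunctional ν₀' (continuous_adeleAddChar K) (ContRepresentation.Equiv.refl Q.1.toContRep))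
      hτQc (finComponentRep hcpt' τQ Q.1 (GLn.sndHom m K (glDiagonal m (AdeleRing (𝓞 K) K) τ)) S₁') ≠ 0 :=
    fun h => hw' (by rw [h, LinearMap.zero_apply])
  -- (5) Borel structures on `GL_m(K_∞)`, and the image Haar measures on `(K_∞ˣ)ᵐ` and `K_∞`
  letI : MeasurableSpace (GL (Fin m) (mixedSpace K)) := borel _
  haveI : BorelSpace (GL (Fin m) (mixedSpace K)) := ⟨rfl⟩
  haveI := locallyCompactSpace_ideleGroup K
  have hμA := isHaarMeasure_map_archTorusOfIdele (n := m) νA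
  have hμK := isHaarMeasure_map_kinfOfMaximalCompact (n := m) νK
  -- (6) the archimedean data from (W-CAFD) on the fact
  obtain ⟨k, e, e', hefin, he'fin, Λ, x₀, hΛ, hsum⟩ :=
    hCAFD (hJ m K) hcpt hcpt' E τP hτPc hτPu hτPi _ hℓ hℓ0 E' τQ hτQc hτQu hτQi _ hℓ' hℓ'0
      ((νA.restrict (unitBox (Set.univ : Set (HeightOneSpectrum (𝓞 K))))).map (archTorusOfIdele m K)) hμA
      (νK.map (kinfOfMaximalCompact m K)) hμK
  -- (7) the realisation of every datum in the translated corner box integral, by (W-CLSD)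
  have hsupp : ∀ w ∉ S₀, ¬ w.asIdeal ∣ 𝔫P * 𝔫Q := fun w hw h => hw <| by
    rcases w.prime.dvd_or_dvd h with h | h
    · exact hsuppP w h
    · exact hsuppQ w h
  have hM1 := fun i : Fin k =>
    hCLSD hm hcpt hcpt' P Q νA νK ν₀ ν₀' hτPc hτQc S₀ τ hD'inf hD'S₀ h𝔫P h𝔫Q hsupp
      S₁ hS₁ S₁' hS₁' (e i) (e' i) (hefin i) (he'fin i)
  choose 𝔫 h𝔫 hsupp𝔫 Φ Φ' sv sv' hΦc hΦ'c hae hae' hcusp hcusp' hinv hinv' κ hκ hbox using hM1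
  -- (8) the data: `c_i := κ_i⁻¹`, `𝔫₀ := ∏ 𝔫_i`, `x₁ := x₀`
  have h𝔫₀ : ∏ i, 𝔫 i ≠ 0 := Finset.prod_ne_zero_iff.2 fun i _ => h𝔫 i
  have h𝔫₀le : ∀ i, ∏ j, 𝔫 j ≤ 𝔫 i := fun i => Ideal.prod_le_inf.trans (Finset.inf_le (Finset.mem_univ i))
  refine ⟨k, fun i => (((κ i : ℝ) : ℂ))⁻¹, Φ, Φ', sv, sv', ∏ i, 𝔫 i, h𝔫₀, ?_, hΦc, hΦ'c, hae, hae', hcusp, hcusp',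
    fun i u hu y => hinv i u (principalCongruenceLevel_mono (m + 1) K h𝔫₀ (h𝔫₀le i) hu) y,
    fun i u hu y => hinv' i u (principalCongruenceLevel_mono m K h𝔫₀ (h𝔫₀le i) hu) y, Λ, x₀, hΛ, ?_⟩
  · -- `𝔫₀` is supported on `S₀`
    intro w hw
    obtain ⟨i, hi⟩ := LocalPairTranslate.exists_dvd_of_dvd_prod 𝔫 hw
    by_contra hwS
    exact hsupp𝔫 i w hwS hi
  · -- `Λ(s) Σ_i κ_i⁻¹ (κ_i Ψ^corner_∞(s; e_i, e'_i)) = Λ(s) Σ_i Ψ^corner_∞(s; e_i, e'_i) = 1`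
    intro s hs
    rw [← hsum s hs]
    congr 1
    refine Finset.sum_congr rfl fun i _ => ?_
    rw [hbox i s, ← mul_assoc, inv_mul_cancel₀ (Complex.ofReal_ne_zero.2 (hκ i).ne'), one_mul]


/-! ### The registered stub -/

/-- **Registered stub `stub_corner_local_control` (W-CLC) of the crux skeleton `PairLBoundaryJS`, line `Sketch`:
the corner LOCAL Rankin–Selberg theory in translate form, granted the archimedean fact of Jacquet (2009)**, from
`corner_local_control_of_parts`, `CornerArchFactorData.stub_corner_arch_factor_data` (W-CAFD) and
`CornerLocalSingleDatum.stub_corner_local_single_datum` (W-CLSD). [cite: CogdellAnalyticTheory2004, §3.2 and §4.1]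
[cite: JacquetArchimedeanRS2009, Thm. 2.7 (i) (p. 10)] -/
theorem stub_corner_local_control :

    (∀ (N : ℕ) (K : Type) [Field K] [NumberField K],
      JacquetArchimedeanRS2009_archRankinSelbergCorner_testVector N K) →
    ∀ {m : ℕ} {K : Type} [Field K] [NumberField K]
      {μ : Measure (AdelicGroupData.gl (m + 1) K).automorphicQuotient}
      [(AdelicGroupData.gl (m + 1) K).IsAutomorphicMeasure μ]
      {μ' : Measure (AdelicGroupData.gl m K).automorphicQuotient} [(AdelicGroupData.gl m K).IsAutomorphicMeasure μ']
      [MeasurableSpace (AdeleRing (𝓞 K) K)] [BorelSpace (AdeleRing (𝓞 K) K)] (_hm : 0 < m)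
      (νA : Measure (Fin m → ideleGroup K)) [IsHaarMeasure νA]
      (νK : Measure ↥(maximalCompactAdelic m K)) [IsHaarMeasure νK]
      (ν₀ : Measure ↥(adelicUnipotent (m + 1) K)) [IsHaarMeasure ν₀]
      (ν₀' : Measure ↥(adelicUnipotent m K)) [IsHaarMeasure ν₀']
      (P : CuspidalAutomorphicRepGL (m + 1) K μ) (Q : CuspidalAutomorphicRepGL m K μ')
      (S₀ : Finset (HeightOneSpectrum (𝓞 K))), (∀ v ∉ S₀, IsUnramifiedAt P.1 v ∧ IsUnramifiedAt Q.1 v) →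
      ∃ (τ : Fin m → ideleGroup K),
      (∀ v ∉ S₀, ∃ (d : Fin (m + 1) → (v.adicCompletion K)ˣ) (a : (v.adicCompletion K)ˣ),
        localComponent v (glDiagonal (m + 1) (AdeleRing (𝓞 K) K) (Fin.snoc τ 1)) =
          diagonalGL (Fin (m + 1)) (v.adicCompletion K) d ∧
        (∀ i j : Fin (m + 1), (i : ℕ) + 1 = j →
          (d i : v.adicCompletion K) * ((d j)⁻¹ : (v.adicCompletion K)ˣ) = a) ∧
        (∀ c ∈ 𝒪[v.adicCompletion K], (adeleAddChar K).adicComponent v (a * c) = 1) ∧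
        ∀ ϖ : v.adicCompletion K, Valued.v ϖ = WithZero.exp (-1 : ℤ) →
          ∃ c ∈ 𝒪[v.adicCompletion K], (adeleAddChar K).adicComponent v (a * (ϖ⁻¹ * c)) ≠ 1) ∧
      ∃ (k : ℕ) (c : Fin k → ℂ)
        (Φ : Fin k → (AdelicGroupData.gl (m + 1) K).automorphicQuotient → ℂ)
        (Φ' : Fin k → (AdelicGroupData.gl m K).automorphicQuotient → ℂ)
        (sv : Fin k → P.1.toSubmodule) (sv' : Fin k → Q.1.toSubmodule) (𝔫₀ : Ideal (𝓞 K)),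
      𝔫₀ ≠ 0 ∧ (∀ w : HeightOneSpectrum (𝓞 K), w.asIdeal ∣ 𝔫₀ → w ∈ S₀) ∧
      (∀ i, Continuous (Φ i)) ∧ (∀ i, Continuous (Φ' i)) ∧
      (∀ i, (((sv i : (AdelicGroupData.gl (m + 1) K).L2 μ) : (AdelicGroupData.gl (m + 1) K).automorphicQuotient → ℂ)
        =ᵐ[μ] Φ i)) ∧
      (∀ i, (((sv' i : (AdelicGroupData.gl m K).L2 μ') : (AdelicGroupData.gl m K).automorphicQuotient → ℂ)
        =ᵐ[μ'] Φ' i)) ∧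
      (∀ i, IsCuspFormGL (m + 1) K (isCompact_glFiniteIntegralLevel_holds (m + 1) K)
        (invQuot (AdelicGroupData.gl (m + 1) K) (Φ i))) ∧
      (∀ i, IsCuspFormGL m K (isCompact_glFiniteIntegralLevel_holds m K) (invQuot (AdelicGroupData.gl m K) (Φ' i))) ∧
      (∀ i, ∀ u ∈ principalCongruenceLevel (m + 1) K 𝔫₀, ∀ y : GL (Fin (m + 1)) (AdeleRing (𝓞 K) K),
        invQuot (AdelicGroupData.gl (m + 1) K) (Φ i) (y * u) = invQuot (AdelicGroupData.gl (m + 1) K) (Φ i) y) ∧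
      (∀ i, ∀ u ∈ principalCongruenceLevel m K 𝔫₀, ∀ y : GL (Fin m) (AdeleRing (𝓞 K) K),
        invQuot (AdelicGroupData.gl m K) (Φ' i) (y * u) = invQuot (AdelicGroupData.gl m K) (Φ' i) y) ∧
      ∃ (Λ : ℂ → ℂ) (x₁ : ℝ), Differentiable ℂ Λ ∧ ∀ s : ℂ, x₁ < s.re →
        Λ s * ∑ i, c i * ∫ p in unitBox {v | v ∉ (↑S₀ : Set (HeightOneSpectrum (𝓞 K)))} ×ˢ Set.univ,
          torusPairIntegrandC m K
            (fun g => whittakerCoeff ν₀ (unipotentTateDomain (m + 1) K) (adeleAddChar K)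
              (invQuot (AdelicGroupData.gl (m + 1) K) (Φ i))
              (glDiagonal (m + 1) (AdeleRing (𝓞 K) K) (Fin.snoc τ 1) * glCorner (AdeleRing (𝓞 K) K) (Nat.le_succ m) g))
            (fun g => star (whittakerCoeff ν₀' (unipotentTateDomain m K) (adeleAddChar K)
              (invQuot (AdelicGroupData.gl m K) (Φ' i)) (glDiagonal m (AdeleRing (𝓞 K) K) τ * g)))
            (fun _ => (1 : ℝ)) s p ∂(νA.prod νK) = 1 :=
  fun hJ => corner_local_control_of_parts CornerArchFactorData.stub_corner_arch_factor_data
    CornerLocalSingleDatum.stub_corner_local_single_datum hJ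

end Summit.Langlands.Langlands.Theorems.CornerLocalControlAsm

end
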